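import Mathlib
import Summits.KontsevichZagierPeriods.KontsevichZagierPeriods.Theorems.SoloInformedQShChains
import Summits.KontsevichZagierPeriods.KontsevichZagierPeriods.Theorems.SoloInformedHarmonicLabels
import HarnessLib
import HarnessLib.Audit

/-!
# SoloInformed — the labelling of the product cube by a quasi-shuffle word (PROGRAMME XLVII, file 3)

Solo programme `solo-KontsevichZagierPeriods-informed`, session s47.

For the harmonic product `u ∗ v` the product cube has the `u`-coordinates `Fin (m+1)` and the
`v`-coordinates `Fin (m'+1)` side by side. A quasi-shuffle word `ω` labels a `u`-coordinate of
block `s` by the POSITION of the step of `ω` consuming `u`-block `s` (`soloInformedPosG isA ω s`),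
and a `v`-coordinate likewise. This file proves the bookkeeping, one side at a time and then glued:

* `soloInformedPosG` and its order characterisation `pos s ≤ t ↔ s < #consumed after t+1 steps`
  (`soloInformed_posG_le_iff`, `soloInformed_posG_eq_iff`);
* one side (`Fin (m+1)`, labels `pos ∘ labU`): the fibre over `t` has `u_{c_t}` elements if step
  `t` consumes a `u`-block and none otherwise (`soloInformed_card_fibre_posG`), and the cumulative
  product `∏_{label ≤ t} x_l` is the value `QV Q c_{t+1}` of the chain of block-end prefix products
  (`soloInformed_prod_filter_posG_le`);
* gluing two sides along `Fin (m+1) ⊕ Fin (m'+1) ≃ Fin (M+1)` (`soloInformedGlue`): fibres add,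
  cumulative products multiply (`soloInformed_card_filter_glue_eq`, `soloInformed_prod_filter_glue_le`).

References: Hoffman 1997 §2; Kontsevich–Zagier 2001 §1.2.
-/

noncomputable section

open Finset
open Literature.NumberTheory.Transcendental

namespace Summit.KontsevichZagierPeriods.KontsevichZagierPeriods.Theorems

open SoloInformedQStep

/-! ## 1. Positions of consuming steps -/

/-- The position (number of earlier steps) of the step consuming the `s`-th block of kind `isX`. -/
def soloInformedPosG (isX : SoloInformedQStep → Bool) : List SoloInformedQStep → ℕ → ℕ
  | [], _ => 0
  | σ :: w, 0 => if isX σ then 0 else soloInformedPosG isX w 0 + 1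
  | σ :: w, s + 1 => if isX σ then soloInformedPosG isX w s + 1 else soloInformedPosG isX w (s + 1) + 1

section pos

variable (isX : SoloInformedQStep → Bool)

/-- **`pos s ≤ t ↔ s < #{blocks consumed by the first t+1 steps}`.** -/
theorem soloInformed_posG_le_iff : ∀ (w : List SoloInformedQStep) (s t : ℕ),
    s < w.countP (isX ·) →
      (soloInformedPosG isX w s ≤ t ↔ s < (w.take (t + 1)).countP (isX ·))
  | [], s, t, h => by simp at h
  | σ :: w, s, t, h => by
    rw [List.countP_cons] at h
    rw [List.take_succ_cons, List.countP_cons]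
    by_cases hσ : isX σ = true
    · rw [if_pos hσ] at h ⊢
      cases s with
      | zero => simp [soloInformedPosG, hσ]
      | succ s =>
        simp only [soloInformedPosG, hσ, if_true]
        cases t with
        | zero => simp
        | succ t =>
          rw [Nat.add_le_add_iff_right, soloInformed_posG_le_iff w s t (by omega)]
          omega
    · rw [if_neg hσ] at h ⊢
      have step : soloInformedPosG isX (σ :: w) s = soloInformedPosG isX w s + 1 := by
        cases s <;> simp [soloInformedPosG, hσ]
      rw [step]
      cases t with
      | zero => simp
      | succ t =>
        rw [Nat.add_le_add_iff_right, soloInformed_posG_le_iff w s t (by omega)]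
        omega

/-- `pos s = t ↔ c_t ≤ s < c_{t+1}` (with `c_t = #{consumed by the first t steps}`). -/
theorem soloInformed_posG_eq_iff (w : List SoloInformedQStep) {s : ℕ} (hs : s < w.countP (isX ·))
    (t : ℕ) : soloInformedPosG isX w s = t ↔
      (w.take t).countP (isX ·) ≤ s ∧ s < (w.take (t + 1)).countP (isX ·) := by
  cases t with
  | zero =>
    rw [← Nat.le_zero, soloInformed_posG_le_iff isX w s 0 hs]
    simp
  | succ t =>
    have h1 := soloInformed_posG_le_iff isX w s (t + 1) hs
    have h2 := soloInformed_posG_le_iff isX w s t hs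
    constructor
    · intro h
      exact ⟨by by_contra h'; have := h2.2 (by omega); omega, h1.1 h.le⟩
    · rintro ⟨ha, hb⟩
      have := h1.2 hb
      by_contra h'
      have h3 : soloInformedPosG isX w s ≤ t := by omega
      have := h2.1 h3
      omega

/-- One more step consumes one more block iff it is of the kind. -/
theorem soloInformed_countP_take_succ (w : List SoloInformedQStep) {t : ℕ} (ht : t < w.length) :
    (w.take (t + 1)).countP (isX ·) = (w.take t).countP (isX ·) + if isX w[t] then 1 else 0 := by
  rw [List.take_succ_eq_append_getElem ht, List.countP_append, List.countP_cons, List.countP_nil,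
    zero_add]

/-- Prefix counts are bounded by the total count. -/
theorem soloInformed_countP_take_le (w : List SoloInformedQStep) (t : ℕ) :
    (w.take t).countP (isX ·) ≤ w.countP (isX ·) :=
  (List.take_sublist t w).countP_le

/-- Values of an `ofFn` chain. -/
theorem soloInformedQV_ofFn {n : ℕ} (F : Fin n → ℝ) {c : ℕ} (hc : c < n) :
    soloInformedQV (List.ofFn F) (c + 1) = F ⟨c, hc⟩ := by
  rw [soloInformedQV_succ, List.getD_eq_getElem _ _ (by simpa using hc), List.getElem_ofFn]

/-- Positions are `< |w|`. -/
theorem soloInformed_posG_lt_length (w : List SoloInformedQStep) {s : ℕ} (hs : s < w.countP (isX ·)) :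
    soloInformedPosG isX w s < w.length := by
  have hne : w ≠ [] := by rintro rfl; simp at hs
  have hl := List.length_pos_of_ne_nil hne
  have h := (soloInformed_posG_le_iff isX w s (w.length - 1) hs).2
    (by rw [Nat.sub_add_cancel hl, List.take_length]; exact hs)
  omega

end pos

/-! ## 2. One side: fibres and cumulative products of `pos ∘ labU` -/

section side

variable {m k : ℕ} {u : List ℕ} (hpos : ∀ i ∈ u, 1 ≤ i) (hw : u.sum = m + 1) (hk : u.length = k + 1)
  (isX : SoloInformedQStep → Bool) (ω : List SoloInformedQStep) (hω : ω.countP (isX ·) = k + 1)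
include hpos hw hk hω

/-- **Fibres of one side.** Over position `t`, the coordinates `l : Fin (m+1)` with
`pos (labU l) = t` number `u_{c_t}` if step `t` is of the kind, and `0` otherwise. -/
theorem soloInformed_card_fibre_posG {t : ℕ} (ht : t < ω.length) :
    (univ.filter fun l : Fin (m + 1) => soloInformedPosG isX ω (soloInformedLabU u l) = t).card =
      if isX ω[t] then u.getD ((ω.take t).countP (isX ·)) 0 else 0 := by
  have hstep := soloInformed_countP_take_succ isX ω ht
  have hle := soloInformed_countP_take_le isX ω (t + 1)
  set c := (ω.take t).countP (isX ·) with hc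
  have hlab : ∀ l : Fin (m + 1), soloInformedLabU u l < ω.countP (isX ·) := fun l => by
    rw [hω]; exact Nat.lt_succ_of_le (soloInformed_labU_le hpos hw hk l.2)
  by_cases hX : isX ω[t] = true
  · rw [if_pos hX] at hstep ⊢
    have hck : c ≤ k := by omega
    have hset : univ.filter (fun l : Fin (m + 1) => soloInformedPosG isX ω (soloInformedLabU u l) = t) =
        univ.filter (fun l : Fin (m + 1) => l.1 < m + 1 ∧ soloInformedLabU u l = c) := by
      ext l
      simp only [mem_filter, mem_univ, true_and, soloInformed_posG_eq_iff isX ω (hlab l), hstep]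
      constructor
      · intro h; exact ⟨l.2, by omega⟩
      · intro h; omega
    rw [hset, soloInformed_card_fibreU hpos hw hk le_rfl hck, List.getD_eq_getElem _ _ (by omega)]
  · rw [if_neg hX] at hstep ⊢
    rw [Finset.card_eq_zero, Finset.filter_eq_empty_iff]
    intro l _ h
    have := (soloInformed_posG_eq_iff isX ω (hlab l) t).1 h
    omega

/-- **Cumulative products of one side.** `∏_{pos (labU l) ≤ t} x_l = QV Q c_{t+1}` where `Q` is the
chain of block-end prefix products of `x`. -/
theorem soloInformed_prod_filter_posG_le (x : Fin (m + 1) → ℝ) (t : ℕ) :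
    ∏ l ∈ univ.filter (fun l : Fin (m + 1) => soloInformedPosG isX ω (soloInformedLabU u l) ≤ t), x l =
      soloInformedQV (List.ofFn fun s : Fin (k + 1) =>
          soloInformedPP x ((soloInformedEnds u).getD s 0 - 1)) ((ω.take (t + 1)).countP (isX ·)) := by
  have hle := soloInformed_countP_take_le isX ω (t + 1)
  set c := (ω.take (t + 1)).countP (isX ·) with hc
  have hlab : ∀ l : Fin (m + 1), soloInformedLabU u l < ω.countP (isX ·) := fun l => by
    rw [hω]; exact Nat.lt_succ_of_le (soloInformed_labU_le hpos hw hk l.2)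
  have hset : univ.filter (fun l : Fin (m + 1) => soloInformedPosG isX ω (soloInformedLabU u l) ≤ t) =
      univ.filter (fun l : Fin (m + 1) => l.1 < m + 1 ∧ soloInformedLabU u l < c) := by
    ext l
    simp only [mem_filter, mem_univ, true_and, soloInformed_posG_le_iff isX ω _ t (hlab l)]
    exact ⟨fun h => ⟨l.2, h⟩, fun h => h.2⟩
  rw [hset, soloInformed_filter_labU_lt hpos hw hk (by omega : c ≤ k + 1)]
  rcases Nat.eq_zero_or_pos c with h0 | hcpos
  · rw [h0, if_pos rfl, prod_empty, soloInformedQV_zero]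
  · obtain ⟨c', hc'⟩ : ∃ c', c = c' + 1 := ⟨c - 1, by omega⟩
    rw [hc', if_neg (Nat.succ_ne_zero c'), Nat.add_sub_cancel,
      soloInformedQV_ofFn _ (show c' < k + 1 by omega)]
    unfold soloInformedPP
    have h1 := soloInformed_one_le_ends_getD hpos (show c' < u.length by omega)
    refine prod_congr ?_ fun _ _ => rfl
    ext l
    simp only [mem_filter, mem_univ, true_and]
    omega

/-- Positions of one side are `≤ |ω| − 1`. -/
theorem soloInformed_posG_labU_le (l : Fin (m + 1)) :
    soloInformedPosG isX ω (soloInformedLabU u l) ≤ ω.length - 1 := by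
  have := soloInformed_posG_lt_length isX ω (s := soloInformedLabU u l)
    (by rw [hω]; exact Nat.lt_succ_of_le (soloInformed_labU_le hpos hw hk l.2))
  omega

end side

/-! ## 3. Gluing two sides -/

section glue

variable {M a b : ℕ} (h : a + b = M + 1) (f : Fin a → ℕ) (g : Fin b → ℕ)

/-- The glued labelling of `Fin (M+1) ≃ Fin a ⊕ Fin b`. -/
def soloInformedGlue (L : Fin (M + 1)) : ℕ := Fin.append f g ((finCongr h).symm L)

/-- The glued labelling on the left part. -/
@[simp] theorem soloInformed_glue_castAdd (l : Fin a) :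
    soloInformedGlue h f g (Fin.cast h (Fin.castAdd b l)) = f l := by
  unfold soloInformedGlue
  have hc : (finCongr h).symm (Fin.cast h (Fin.castAdd b l)) = Fin.castAdd b l := Fin.ext rfl
  rw [hc]
  exact Fin.append_left f g l

/-- The glued labelling on the right part. -/
@[simp] theorem soloInformed_glue_natAdd (l : Fin b) :
    soloInformedGlue h f g (Fin.cast h (Fin.natAdd a l)) = g l := by
  unfold soloInformedGlue
  have hc : (finCongr h).symm (Fin.cast h (Fin.natAdd a l)) = Fin.natAdd a l := Fin.ext rfl
  rw [hc]
  exact Fin.append_right f g l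

/-- **Fibres add.** -/
theorem soloInformed_card_filter_glue_eq (t : ℕ) :
    (univ.filter fun L : Fin (M + 1) => soloInformedGlue h f g L = t).card =
      (univ.filter fun l : Fin a => f l = t).card + (univ.filter fun l : Fin b => g l = t).card := by
  rw [card_filter, card_filter, card_filter, ← Equiv.sum_comp (finCongr h), Fin.sum_univ_add]
  simp

/-- **Cumulative products multiply.** -/
theorem soloInformed_prod_filter_glue_le (w : Fin (M + 1) → ℝ) (t : ℕ) :
    ∏ L ∈ univ.filter (fun L : Fin (M + 1) => soloInformedGlue h f g L ≤ t), w L =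
      (∏ l ∈ univ.filter (fun l : Fin a => f l ≤ t), w (Fin.cast h (Fin.castAdd b l))) *
        ∏ l ∈ univ.filter (fun l : Fin b => g l ≤ t), w (Fin.cast h (Fin.natAdd a l)) := by
  rw [prod_filter, prod_filter, prod_filter,
    ← Equiv.prod_comp (finCongr h) (fun L => if soloInformedGlue h f g L ≤ t then w L else 1),
    Fin.prod_univ_add]
  simp

/-- A bound on all glued labels. -/
theorem soloInformed_glue_le {T : ℕ} (hf : ∀ l, f l ≤ T) (hg : ∀ l, g l ≤ T) (L : Fin (M + 1)) :
    soloInformedGlue h f g L ≤ T := by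
  obtain ⟨i, rfl⟩ := (finCongr h).surjective L
  induction i using Fin.addCases with
  | left i => simpa using hf i
  | right j => simpa using hg j

end glue

/-! ## 4. The closed form of the word index -/

/-- **Entry formula for `idxW`.** Entry `t` is `[A-ish] u_{i + c^A_t} + [B-ish] v_{j + c^B_t}`. -/
theorem soloInformed_idxW_eq_ofFn (u v : List ℕ) :
    ∀ (w : List SoloInformedQStep) (i j : ℕ),
      soloInformedIdxW u v i j w = List.ofFn fun t : Fin w.length =>
        (if soloInformedIsA (w.getD t A) then u.getD (i + soloInformedCntA (w.take t)) 0 else 0) +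
          (if soloInformedIsB (w.getD t A) then v.getD (j + soloInformedCntB (w.take t)) 0 else 0)
  | [], _, _ => rfl
  | s :: w, i, j => by
    rw [List.length_cons, List.ofFn_succ]
    cases s <;>
      simp only [soloInformedIdxW, Fin.val_zero, List.getD_cons_zero, List.take_zero,
        soloInformed_cntA_nil, soloInformed_cntB_nil, soloInformedIsA, soloInformedIsB, if_true,
        Bool.false_eq_true, if_false, add_zero, Fin.val_succ, List.getD_cons_succ, List.take_succ_cons,
        soloInformed_cntA_cons, soloInformed_cntB_cons, soloInformed_idxW_eq_ofFn u v w, List.cons.injEq,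
        true_and, zero_add] <;>
      (congr 1; funext t; congr 1 <;> congr 2 <;> omega)

end Summit.KontsevichZagierPeriods.KontsevichZagierPeriods.Theorems
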